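/-
Copyright (c) 2026 the pub-hodgecm-mathlib formalisation cell (harness21).  Prover seat hodgecm-mathlib-LH4-p09 (g3), req620 Track A «(D-RAM) FOUR-FRAME» squad
(unit U3_Laws, (R-18) «K-ABS-R := NI2 ⊕ KMS», κ-STAGE B brick κB-G «GLUED-STRATA κ-SOCKETS» dealt by LH4-plan (g11) WORD #32 (3); plan LH4-p05 (g3)
`F0/P3c/LH4/LH4-p05/g3/PLAN-KMS-modKappaStageB.v1.LH4p05g3.md` §4; letter `F0/P3c/LH4/LH4-p09/g3/LETTER-kappaBG-RHS.v1.LH4p09g3.md`).  FILE κG-A2.  2026-09-04.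
-/
import Summits.HodgeConjecture.HodgeConjecture.Theorems.F0P3cDyRamDiagonalKappaGluedClassForm  -- κG-A1 (this seat): `isVertexLattice_zero_latt_glued_rep`, `kappaCount_mapGL_diagGLUnits`, `chiVec_glued_rep`; brings ★ Fκ2 `KappaCountEval`, ★ Fκ1, ★ B5 (i)
import Summits.HodgeConjecture.HodgeConjecture.Theorems.F0P3cDyRamDiagonalGluedFixedStabiliser  -- ★ B5 (iii) FILE 1 (F0P3-p01 (g31)): `mem_fixedUnitStabilizer_latt_glued_iff` ((b) ∧ (c′) with a lineariser)
import Summits.HodgeConjecture.HodgeConjecture.Theorems.F0P3cDyRamDiagonalStratumTools         -- ★ (LH4-p13 (g2)): `fixedUnitStabilizer_mapGL_diagGLUnits`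
import Literature.NumberTheory.LocalFields.WildQuadraticDatumNormSurjective                     -- ★ p854729: `exists_mul_map_eq_of_isRamifiedQuadraticDatum` (deep fixed one-units are norms)
import Literature.NumberTheory.LocalFields.WildQuadraticDatumNonNormUnit                        -- ★ p855483 (LH4-p09 (g2)): `exists_nonnorm_dichotomy_of_isRamifiedQuadraticDatum` (NI2 with a non-norm witness)
import Literature.NumberTheory.LocalFields.ValuedCompleteIsAdicComplete                         -- ★ (LH4-p02): `isAdicComplete_valuedInteger_of_completeSpace`
import Literature.NumberTheory.LocalFields.WildQuadraticDatumNormSignConductor                   -- ★ (LH4-p06 (g3)) κ-toolkit: `normSign_eq_one_of_fixed_of_v_sub_one_le`, `normSign_mul_of_fixed`, `exists_nonnorm_dichotomy`, `exists_fixed_unit_not_norm_v_sub_one_le`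
import HarnessLib

/-!
# Crux `H413`, line LH4 «(D-RAM) FOUR-FRAME» road — unit U3_Laws (iii), κ-STAGE B brick κB-G, FILE κG-A2 «THE κ-COUNT OF A GLUED CLASS»:
# `kappaCount σ ϖ 0 i` on the glued representative `latt V(1, 1, g)` — the ALIVE windows of `S_F`, the killers, the value

Cell `hodgecm-mathlib` (D-0151), FLOOR 0, crux item H413 = `stmt-HodgeConjecture-24833`, route of record `HCCMUnconditional`; squad F0∕P3c∕LH4 (req618∕req620).  THEOREMS ONLY
(no `def`, no instance, no notation, no `sorry`, default heartbeats); lane `--supports stmt-HodgeConjecture-24833 --as helper` (count-neutral).  LAW-FREE.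

THE OBJECT (LH4-p10 (g2) MEMO v2 §4; ★ B5 (i)–(iv)).  In the (S-fin) count of the four-frame census the GLUED stratum `G₁(2ρ, 2t)` of axis `(2ρ, 2ρ+2t, 2ρ+2t)` consists of the lattices
`latt V(x, ζ, y″)`, `V = (1 0 0; x ϖ^ρ 0; xζ+y″ ϖ^ρζ ϖ^{2ρ+2t})`, `|x| = |ζ| = 1`, `|y″| = |ϖ|^{2t}`; the dualisable ones are the unit-torus orbits `𝒯·latt V(1, 1, g)` of the
representatives with `κ = y″∕(xζ) = g` a `σ`-FIXED element of valuation `|ϖ|^{2t}` (★ (iv-a) `…GluedTorusOrbits`, (iv-c) `…GluedClassRepresentatives`).  The κ-twisted census (KMS road,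
LH4-p05 (g3) PLAN v1) weights each lattice by the SIGNED κ-COUNT `kappaCount σ ϖ 0 i M` (★ Fκ1 p856497) which, on a normalised lattice with a type-0 polarisation `D₁`, is
`[χ_i ≡ 1 on S_F(M)] · χ_i(D₁)` (Fκ2 `kappaCount_zero_eq_of_dichotomy`; `χ_i(D) = Π_{j ≠ i} ω(D_j)`, `ω = normSign σ`).  THIS FILE evaluates it on the glued classes:
FILE κG-A1 `F0P3cDyRamDiagonalKappaGluedClassForm` (this seat) supplies: §1 the EXPLICIT type-0 polarisation `D(g) = π₀^{−(ρ+t)}·(g, 1, −1∕(1+g))` of `latt V(1,1,g)`, §2 the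
constancy of `kappaCount σ ϖ tv i` on `(K^×)³`-orbits, §3 `χ_i(D(g))` = `ω(−1)ω(1+g)` ∕ `ω(−1)ω(g)ω(1+g)` ∕ `ω(g)`.  THIS FILE:
* §4 the ALIVE windows on `S_F(latt V(1,1,g)) = {u ∈ 𝒰 : |u₂−u₁| ≤ |ϖ|^{ρ+2t}, |(u₂−u₁)∕g + (u₂−u₀)| ≤ |ϖ|^{2ρ}}` (★ `mem_fixedUnitStabilizer_latt_glued_iff`, lineariser `1∕g`):
  `χ_0 ≡ 1` if `d ≤ t + ⌈ρ∕2⌉`, `χ_1, χ_2 ≡ 1` if `d ≤ ⌈ρ∕2⌉` (deep fixed one-units are norms, ★ p854729, under completeness); conversely a `σ`-fixed NON-norm one-unit `n₀` of the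
  right level KILLS the window: `u = (1 + (1−n₀)∕g, n₀, 1)` (`χ_0(u) = ω(n₀)`) resp. `u = (n₀, 1 − (n₀−1)g, 1)` (`χ_1(u) = ω(n₀)`, `χ_2(u) = ω(n₀)·ω(1 − (n₀−1)g)`), both in `S_F`
  with the corner congruence holding EXACTLY (the level-`(d−1)` non-norm itself is LH4-p04 (g2)'s ★-to-be `exists_fixed_unit_not_norm_of_level`; here it is a hypothesis).
* §5 HEAD `kappaCount_zero_latt_glued_rep` — `kappaCount σ ϖ 0 i (latt V(1,1,g)) = if window_i then value_i(g) else 0` under the datum, completeness and the killer hypotheses.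
HONEST LABEL.  Count-neutral (`--supports`); nothing printed is asserted; (KMS)∕(KSS) stay PROVER TARGETS (empirical census laws in diagonal-model currency); `HC_CM` is proved only
modulo the 7 printed citations (2 remaining named inputs: hLiu418 = `stmt-HodgeConjecture-24832`, h413 = `stmt-HodgeConjecture-24833`) until rung 0 closes.

## References
* [Kottwitz1986BaseChangeUnits] R. E. Kottwitz, *Base change for unit elements of Hecke algebras*, Compositio Math. 60 (1986), §1 pp. 240–241 (κ-orbital integrals of units as
  signed lattice counts modulo the torus).
* [LanglandsShelstad1987] R. P. Langlands, D. Shelstad, *On the definition of transfer factors*, Math. Ann. 278 (1987), §3 (κ as a character of `H¹(F, T)`).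
* [Serre1979] J.-P. Serre, *Local Fields*, GTM 67 (1979), Ch. V §3 Prop. 5, Cor. 3 (the unit norm index and the conductor of a ramified quadratic extension).
* [Jacobowitz1962] R. Jacobowitz, *Hermitian forms over local fields*, Amer. J. Math. 84 (1962), §7 (Gram matrices of unimodular lattices).
-/

set_option autoImplicit false

noncomputable section

namespace Summit.HodgeConjecture.HodgeConjecture.Cruxes.H413.F0P3cDyRamDiagonalKappaGluedClass

open Matrix
open Literature.NumberTheory.Automorphic Literature.NumberTheory.Automorphic.HermitianLattice Literature.NumberTheory.Automorphic.UnitaryGroup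
open Literature.NumberTheory.Automorphic.UnitaryLatticeTree Literature.NumberTheory.Automorphic.UnitaryThreeFourFrame
open Literature.NumberTheory.LocalFields.WildQuadraticDatum
open Summit.HodgeConjecture.HodgeConjecture.Cruxes.H413.F0P3cDyRamDiagonalTorusDefs
open Summit.HodgeConjecture.HodgeConjecture.Cruxes.H413.F0P3cDyRamDiagonalStrataDefs
open Summit.HodgeConjecture.HodgeConjecture.Cruxes.H413.F0P3cDyRamDiagonalKappaCountDefs
open Summit.HodgeConjecture.HodgeConjecture.Cruxes.H413.F0P3cDyRamDiagonalKappaCountEval hiding normSign_mul_of_dichotomy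
open Summit.HodgeConjecture.HodgeConjecture.Cruxes.H413.F0P3cDyRamFixedCountDiagonalModel (normSign_mul_norm)
open Summit.HodgeConjecture.HodgeConjecture.Cruxes.H413.F0P3cDyRamStableSumSignClasses (normSign_eq_one_or)
open Summit.HodgeConjecture.HodgeConjecture.Cruxes.H413.F0P3cDyRamDiagonalKappaGluedClassForm
open Summit.HodgeConjecture.HodgeConjecture.Cruxes.H413.F0P3cDyRamDiagonalGluedFixedStabiliser (mem_fixedUnitStabilizer_latt_glued_iff)
open Summit.HodgeConjecture.HodgeConjecture.Cruxes.H413.F0P3cDyRamDiagonalStratumTools (fixedUnitStabilizer_mapGL_diagGLUnits)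
open scoped Valued WithZero Matrix MatrixGroups

variable {K : Type} [Field K] [Valued K ℤᵐ⁰]

/-! ## §4  The fixed stabiliser of the representative and the ALIVE windows -/

/-- **`S_F(latt V(1,1,g))`** (★ `mem_fixedUnitStabilizer_latt_glued_iff` with the lineariser `g⁻¹`): for `u ∈ 𝒰`,
`u ∈ S_F ⟺ |u₂ − u₁| ≤ |ϖ|^{ρ+2t} ∧ |g⁻¹(u₂ − u₁) + (u₂ − u₀)| ≤ |ϖ|^{2ρ}`. [cite: Kottwitz1986BaseChangeUnits, §1 pp. 240–241] -/
theorem mem_fixedUnitStabilizer_glued_rep_iff {σ : K →+* K} {ϖ : K} (hϖ0 : ϖ ≠ 0) (hϖ1 : Valued.v ϖ ≤ 1) (ρ t : ℕ) {g : K}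
    (hg : Valued.v g = Valued.v ϖ ^ (2 * t)) (V : GL (Fin 3) K)
    (hV : (V : Matrix (Fin 3) (Fin 3) K) = !![1, 0, 0; 1, ϖ ^ ρ, 0; 1 * 1 + g, ϖ ^ ρ * 1, ϖ ^ (2 * ρ + 2 * t)])
    {u : Fin 3 → Kˣ} (hu : u ∈ fixedUnitTorus σ 3) :
    u ∈ fixedUnitStabilizer σ (latt (V : Matrix (Fin 3) (Fin 3) K)) ↔
      Valued.v ((u 2 : K) - u 1) ≤ Valued.v ϖ ^ (ρ + 2 * t) ∧ Valued.v (g⁻¹ * ((u 2 : K) - u 1) + ((u 2 : K) - u 0)) ≤ Valued.v ϖ ^ (2 * ρ) := by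
  have hvϖ : 0 < Valued.v ϖ := (Valuation.pos_iff _).2 hϖ0
  have hg0 : g ≠ 0 := fun h => by rw [h, map_zero] at hg; exact (pow_ne_zero _ hvϖ.ne') hg.symm
  have hg' : Valued.v g⁻¹ * Valued.v ϖ ^ (2 * t) ≤ 1 := by rw [map_inv₀, hg, inv_mul_cancel₀ (pow_ne_zero _ hvϖ.ne')]
  have hlin : Valued.v ((1 : K) * 1 - g⁻¹ * g) ≤ Valued.v ϖ ^ ρ := by rw [one_mul, inv_mul_cancel₀ hg0, sub_self, map_zero]; exact zero_le
  exact mem_fixedUnitStabilizer_latt_glued_iff hϖ0 hϖ1 ρ (2 * t) (x := 1) (ζ := 1) (by simp) (by simp) hg hg' hlin V hV hu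

section Alive

variable [CompleteSpace K] [Finite 𝓀[K]] {σ : K →+* K} {ϖ : K} {d t₂ : ℕ}

/-- **WINDOW `i = 0`: `d ≤ t + ⌈ρ∕2⌉` ⟹ `χ_0 ≡ 1` on `S_F(latt V(1,1,g))`**: `χ_0(u) = ω(u₁u₂) = ω(u₁∕u₂)` and `|u₁∕u₂ − 1| ≤ |ϖ|^{ρ+2t}` with `2d − 1 ≤ ρ + 2t` (★ deep norms).
[cite: Serre1979, Ch. V §3 Prop. 5, Cor. 3] [cite: LanglandsShelstad1987, §3] -/
theorem chiVec_zero_eq_one_of_window (hD : IsRamifiedQuadraticDatum σ ϖ d t₂) {ρ t : ℕ} (hwin : 2 * d ≤ ρ + 2 * t + 1)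
    {u : Fin 3 → Kˣ} (hu : u ∈ fixedUnitTorus σ 3) (hb : Valued.v ((u 2 : K) - u 1) ≤ Valued.v ϖ ^ (ρ + 2 * t)) :
    chiVec σ 0 (fun j => ((u j : Kˣ) : K)) = 1 := by
  obtain ⟨hu1, hu2⟩ := (mem_fixedUnitTorus_iff σ u).1 hu
  have h0 : ∀ j, ((u j : Kˣ) : K) ≠ 0 := fun j => (u j).ne_zero
  -- `χ_0(u) = ω(u₁ u₂) = ω(u₁∕u₂)`
  have e : ((u 1 : K)) * (u 2 : K) = ((u 1 : K) / u 2) * ((u 2 : K) * σ (u 2 : K)) := by rw [hu2 2]; field_simp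
  have hq : σ ((u 1 : K) / u 2) = (u 1 : K) / u 2 := by rw [map_div₀, hu2, hu2]
  have hq1 : Valued.v ((u 1 : K) / u 2 - 1) ≤ Valued.v ϖ ^ (ρ + 2 * t) := by
    rw [div_sub_one (h0 2), map_div₀, hu1 2, div_one, show ((u 1 : K)) - u 2 = -(((u 2 : K)) - u 1) by ring, Valuation.map_neg]; exact hb
  rw [chiVec_eq]
  simp only [Fin.isValue, Matrix.cons_val_zero]
  rw [← normSign_mul_of_fixed hD (hu2 1) (hu2 2) (h0 1) (h0 2), e, normSign_mul_norm σ _ (h0 2),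
    normSign_eq_one_of_fixed_of_v_sub_one_le hD hq (n := ρ + 2 * t) (by omega) hq1]

/-- **WINDOW `i = 1, 2`: `d ≤ ⌈ρ∕2⌉` ⟹ `χ_1, χ_2 ≡ 1` on `S_F(latt V(1,1,g))`**: with `a = u₁∕u₂`, `b = u₀∕u₂` the congruences give `|a − 1| ≤ |ϖ|^{ρ+2t}` and
`|b − 1| ≤ |ϖ|^ρ` (`|g⁻¹(u₂−u₁)| ≤ |ϖ|^ρ`), and `2d − 1 ≤ ρ`; `χ_1(u) = ω(b)`, `χ_2(u) = ω(b)ω(a)`. [cite: Serre1979, Ch. V §3 Prop. 5, Cor. 3] [cite: LanglandsShelstad1987, §3] -/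
theorem chiVec_one_two_eq_one_of_window (hD : IsRamifiedQuadraticDatum σ ϖ d t₂) {ρ t : ℕ} (hwin : 2 * d ≤ ρ + 1) {g : K}
    (hg : Valued.v g = Valued.v ϖ ^ (2 * t)) {u : Fin 3 → Kˣ} (hu : u ∈ fixedUnitTorus σ 3)
    (hb : Valued.v ((u 2 : K) - u 1) ≤ Valued.v ϖ ^ (ρ + 2 * t)) (hc : Valued.v (g⁻¹ * ((u 2 : K) - u 1) + ((u 2 : K) - u 0)) ≤ Valued.v ϖ ^ (2 * ρ)) :
    chiVec σ 1 (fun j => ((u j : Kˣ) : K)) = 1 ∧ chiVec σ 2 (fun j => ((u j : Kˣ) : K)) = 1 := by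
  have hϖ := hD.2.2.1
  have hϖ0 : ϖ ≠ 0 := (Valuation.ne_zero_iff _).1 (by rw [hϖ]; exact WithZero.exp_ne_zero)
  have hϖ1 : Valued.v ϖ < 1 := by rw [hϖ, ← WithZero.exp_zero, WithZero.exp_lt_exp]; norm_num
  have hvϖ : 0 < Valued.v ϖ := (Valuation.pos_iff _).2 hϖ0
  obtain ⟨hu1, hu2⟩ := (mem_fixedUnitTorus_iff σ u).1 hu
  have h0 : ∀ j, ((u j : Kˣ) : K) ≠ 0 := fun j => (u j).ne_zero
  have hg0 : g ≠ 0 := fun h => by rw [h, map_zero] at hg; exact (pow_ne_zero _ hvϖ.ne') hg.symm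
  -- `a = u₁∕u₂`
  have hσa : σ ((u 1 : K) / u 2) = (u 1 : K) / u 2 := by rw [map_div₀, hu2, hu2]
  have ha1 : Valued.v ((u 1 : K) / u 2 - 1) ≤ Valued.v ϖ ^ ρ := by
    rw [div_sub_one (h0 2), map_div₀, hu1 2, div_one, show ((u 1 : K)) - u 2 = -(((u 2 : K)) - u 1) by ring, Valuation.map_neg]
    refine hb.trans ?_
    rw [pow_add]; exact mul_le_of_le_one_right zero_le (pow_le_one₀ zero_le hϖ1.le)
  -- `b = u₀∕u₂`: `b − 1 = (g⁻¹(u₂−u₁) − ε)∕u₂`, `ε` the corner quantity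
  have hσb : σ ((u 0 : K) / u 2) = (u 0 : K) / u 2 := by rw [map_div₀, hu2, hu2]
  have hb1 : Valued.v ((u 0 : K) / u 2 - 1) ≤ Valued.v ϖ ^ ρ := by
    have e : (u 0 : K) / u 2 - 1 = (g⁻¹ * ((u 2 : K) - u 1) - (g⁻¹ * ((u 2 : K) - u 1) + ((u 2 : K) - u 0))) / u 2 := by
      field_simp; ring
    rw [e, map_div₀, hu1 2, div_one]
    refine (Valuation.map_sub _ _ _).trans (max_le ?_ (hc.trans ?_))
    · rw [map_mul, map_inv₀, hg]
      calc (Valued.v ϖ ^ (2 * t))⁻¹ * Valued.v ((u 2 : K) - u 1) ≤ (Valued.v ϖ ^ (2 * t))⁻¹ * Valued.v ϖ ^ (ρ + 2 * t) :=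
            mul_le_mul_right hb _
        _ = Valued.v ϖ ^ ρ := by rw [pow_add, mul_comm (Valued.v ϖ ^ ρ), ← mul_assoc, inv_mul_cancel₀ (pow_ne_zero _ hvϖ.ne'), one_mul]
    · rw [two_mul, pow_add]; exact mul_le_of_le_one_right zero_le (pow_le_one₀ zero_le hϖ1.le)
  have hωa : normSign σ ((u 1 : K) / u 2) = 1 := normSign_eq_one_of_fixed_of_v_sub_one_le hD hσa (n := ρ) (by omega) ha1
  have hωb : normSign σ ((u 0 : K) / u 2) = 1 := normSign_eq_one_of_fixed_of_v_sub_one_le hD hσb (n := ρ) (by omega) hb1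
  have hN2 : ∀ x : K, normSign σ (x * ((u 2 : K) * (u 2 : K))) = normSign σ x := fun x => by
    nth_rw 2 [← hu2 2]; exact normSign_mul_norm σ x (h0 2)
  have e1 : ((u 0 : K)) * (u 2 : K) = ((u 0 : K) / u 2) * ((u 2 : K) * (u 2 : K)) := by field_simp
  have e2 : ((u 0 : K)) * (u 1 : K) = (((u 0 : K) / u 2) * ((u 1 : K) / u 2)) * ((u 2 : K) * (u 2 : K)) := by field_simp
  have hdiv0 : ∀ j, (u j : K) / u 2 ≠ 0 := fun j => div_ne_zero (h0 j) (h0 2)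
  rw [chiVec_eq, chiVec_eq]
  simp only [Fin.isValue, Matrix.cons_val_one, Matrix.cons_val_zero, Matrix.cons_val_two, Matrix.head_cons, Matrix.tail_cons]
  refine ⟨?_, ?_⟩
  · rw [← normSign_mul_of_fixed hD (hu2 0) (hu2 2) (h0 0) (h0 2), e1, hN2, hωb]
  · rw [← normSign_mul_of_fixed hD (hu2 0) (hu2 1) (h0 0) (h0 1), e2, hN2, normSign_mul_of_fixed hD hσb hσa (hdiv0 0) (hdiv0 1), hωa, hωb, mul_one]

end Alive

/-! ## §4b  The killers: a non-norm fixed one-unit of the right level puts a `u` with `χ_i(u) = −1` into `S_F` -/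

/-- **KILLER FOR `i = 0`**: a `σ`-fixed NON-norm unit `n₀` with `|n₀ − 1| ≤ |ϖ|^{ρ+2t}` (`ρ ≥ 1`) gives `u = (1 + g⁻¹(1 − n₀), n₀, 1) ∈ S_F(latt V(1,1,g))` with
`χ_0(u) = ω(n₀)·ω(1) = −1` (the corner quantity vanishes EXACTLY). [cite: Kottwitz1986BaseChangeUnits, §1 pp. 240–241] [cite: LanglandsShelstad1987, §3] -/
theorem exists_mem_fixedUnitStabilizer_chiVec_zero_ne_one {σ : K →+* K} {ϖ : K} (hϖ0 : ϖ ≠ 0) (hϖ1 : Valued.v ϖ < 1)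
    {ρ : ℕ} (hρ : 1 ≤ ρ) (t : ℕ) {g : K} (hσg : σ g = g) (hg : Valued.v g = Valued.v ϖ ^ (2 * t)) (V : GL (Fin 3) K)
    (hV : (V : Matrix (Fin 3) (Fin 3) K) = !![1, 0, 0; 1, ϖ ^ ρ, 0; 1 * 1 + g, ϖ ^ ρ * 1, ϖ ^ (2 * ρ + 2 * t)])
    {n₀ : K} (hσn₀ : σ n₀ = n₀) (hn₀1 : Valued.v n₀ = 1) (hn₀ : Valued.v (n₀ - 1) ≤ Valued.v ϖ ^ (ρ + 2 * t)) (hn₀n : ¬ ∃ z : K, z * σ z = n₀) :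
    ∃ u ∈ fixedUnitStabilizer σ (latt (V : Matrix (Fin 3) (Fin 3) K)), chiVec σ 0 (fun j => ((u j : Kˣ) : K)) ≠ 1 := by
  have hvϖ : 0 < Valued.v ϖ := (Valuation.pos_iff _).2 hϖ0
  have hg0 : g ≠ 0 := fun h => by rw [h, map_zero] at hg; exact (pow_ne_zero _ hvϖ.ne') hg.symm
  have hn₀0 : n₀ ≠ 0 := fun h => by rw [h, map_zero] at hn₀1; exact zero_ne_one hn₀1
  -- `u₀ = 1 + g⁻¹(1 − n₀)` is a fixed unit
  have hsmall : Valued.v (g⁻¹ * (1 - n₀)) < 1 := by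
    rw [map_mul, map_inv₀, hg, show (1 : K) - n₀ = -(n₀ - 1) by ring, Valuation.map_neg]
    calc (Valued.v ϖ ^ (2 * t))⁻¹ * Valued.v (n₀ - 1) ≤ (Valued.v ϖ ^ (2 * t))⁻¹ * Valued.v ϖ ^ (ρ + 2 * t) := mul_le_mul_right hn₀ _
      _ = Valued.v ϖ ^ ρ := by rw [pow_add, mul_comm (Valued.v ϖ ^ ρ), ← mul_assoc, inv_mul_cancel₀ (pow_ne_zero _ hvϖ.ne'), one_mul]
      _ < 1 := pow_lt_one₀ zero_le hϖ1 (by omega)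
  have hu₀1 : Valued.v (1 + g⁻¹ * (1 - n₀)) = 1 := Valued.v.map_one_add_of_lt hsmall
  have hu₀0 : 1 + g⁻¹ * (1 - n₀) ≠ 0 := fun h => by rw [h, map_zero] at hu₀1; exact zero_ne_one hu₀1
  have hσu₀ : σ (1 + g⁻¹ * (1 - n₀)) = 1 + g⁻¹ * (1 - n₀) := by rw [map_add, map_one, map_mul, map_inv₀, hσg, map_sub, map_one, hσn₀]
  let u : Fin 3 → Kˣ := ![Units.mk0 _ hu₀0, Units.mk0 n₀ hn₀0, 1]
  have hu0 : ((u 0 : Kˣ) : K) = 1 + g⁻¹ * (1 - n₀) := rfl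
  have hu1 : ((u 1 : Kˣ) : K) = n₀ := rfl
  have hu2 : ((u 2 : Kˣ) : K) = 1 := rfl
  have hu : u ∈ fixedUnitTorus σ 3 := by
    rw [mem_fixedUnitTorus_iff]
    refine ⟨fun j => ?_, fun j => ?_⟩
    · fin_cases j
      · exact hu₀1
      · exact hn₀1
      · exact map_one _
    · fin_cases j
      · exact hσu₀
      · exact hσn₀
      · exact map_one _
  refine ⟨u, ?_, ?_⟩
  · refine (mem_fixedUnitStabilizer_glued_rep_iff hϖ0 hϖ1.le ρ t hg V hV hu).2 ⟨?_, ?_⟩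
    · rw [hu2, hu1, show (1 : K) - n₀ = -(n₀ - 1) by ring, Valuation.map_neg]; exact hn₀
    · rw [hu2, hu1, hu0, show g⁻¹ * (1 - n₀) + (1 - (1 + g⁻¹ * (1 - n₀))) = (0 : K) by ring, map_zero]; exact zero_le
  · rw [chiVec_eq]
    simp only [Fin.isValue, Matrix.cons_val_zero, hu1, hu2, normSign_one σ, mul_one, normSign_of_not_isNorm σ hn₀n]
    decide

/-- **KILLER FOR `i = 1, 2`**: a `σ`-fixed NON-norm unit `n₀` with `|n₀ − 1| ≤ |ϖ|^ρ` gives `u = (n₀, 1 − (n₀−1)g, 1) ∈ S_F(latt V(1,1,g))` (corner quantity EXACTLY `0`) with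
`χ_1(u) = ω(n₀)·ω(1) = −1` and, if moreover `ω(1 − (n₀−1)g) = 1`, `χ_2(u) = ω(n₀)·ω(1 − (n₀−1)g) = −1`. [cite: Kottwitz1986BaseChangeUnits, §1 pp. 240–241] [cite: LanglandsShelstad1987, §3] -/
theorem exists_mem_fixedUnitStabilizer_chiVec_one_two_ne_one {σ : K →+* K} {ϖ : K} (hϖ0 : ϖ ≠ 0) (hϖ1 : Valued.v ϖ < 1)
    (ρ : ℕ) {t : ℕ} (ht : 1 ≤ t) {g : K} (hσg : σ g = g) (hg : Valued.v g = Valued.v ϖ ^ (2 * t)) (V : GL (Fin 3) K)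
    (hV : (V : Matrix (Fin 3) (Fin 3) K) = !![1, 0, 0; 1, ϖ ^ ρ, 0; 1 * 1 + g, ϖ ^ ρ * 1, ϖ ^ (2 * ρ + 2 * t)])
    {n₀ : K} (hσn₀ : σ n₀ = n₀) (hn₀1 : Valued.v n₀ = 1) (hn₀ : Valued.v (n₀ - 1) ≤ Valued.v ϖ ^ ρ) (hn₀n : ¬ ∃ z : K, z * σ z = n₀) :
    ∃ u ∈ fixedUnitStabilizer σ (latt (V : Matrix (Fin 3) (Fin 3) K)),
      chiVec σ 1 (fun j => ((u j : Kˣ) : K)) ≠ 1 ∧ (normSign σ (1 - (n₀ - 1) * g) = 1 → chiVec σ 2 (fun j => ((u j : Kˣ) : K)) ≠ 1) := by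
  have hvϖ : 0 < Valued.v ϖ := (Valuation.pos_iff _).2 hϖ0
  have hg0 : g ≠ 0 := fun h => by rw [h, map_zero] at hg; exact (pow_ne_zero _ hvϖ.ne') hg.symm
  have hn₀0 : n₀ ≠ 0 := fun h => by rw [h, map_zero] at hn₀1; exact zero_ne_one hn₀1
  -- `u₁ = 1 − (n₀ − 1)g` is a fixed unit
  have hm : Valued.v ((n₀ - 1) * g) ≤ Valued.v ϖ ^ (ρ + 2 * t) := by rw [map_mul, hg, pow_add]; exact mul_le_mul_left hn₀ _
  have hsmall : Valued.v (-((n₀ - 1) * g)) < 1 := by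
    rw [Valuation.map_neg]; exact hm.trans_lt (pow_lt_one₀ zero_le hϖ1 (by omega))
  have hu₁1 : Valued.v (1 - (n₀ - 1) * g) = 1 := by rw [sub_eq_add_neg]; exact Valued.v.map_one_add_of_lt hsmall
  have hu₁0 : 1 - (n₀ - 1) * g ≠ 0 := fun h => by rw [h, map_zero] at hu₁1; exact zero_ne_one hu₁1
  have hσu₁ : σ (1 - (n₀ - 1) * g) = 1 - (n₀ - 1) * g := by rw [map_sub, map_one, map_mul, map_sub, map_one, hσn₀, hσg]
  let u : Fin 3 → Kˣ := ![Units.mk0 n₀ hn₀0, Units.mk0 _ hu₁0, 1]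
  have hu0 : ((u 0 : Kˣ) : K) = n₀ := rfl
  have hu1 : ((u 1 : Kˣ) : K) = 1 - (n₀ - 1) * g := rfl
  have hu2 : ((u 2 : Kˣ) : K) = 1 := rfl
  have hu : u ∈ fixedUnitTorus σ 3 := by
    rw [mem_fixedUnitTorus_iff]
    refine ⟨fun j => ?_, fun j => ?_⟩
    · fin_cases j
      · exact hn₀1
      · exact hu₁1
      · exact map_one _
    · fin_cases j
      · exact hσn₀
      · exact hσu₁
      · exact map_one _
  refine ⟨u, ?_, ?_, fun hω => ?_⟩
  · refine (mem_fixedUnitStabilizer_glued_rep_iff hϖ0 hϖ1.le ρ t hg V hV hu).2 ⟨?_, ?_⟩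
    · rw [hu2, hu1, show (1 : K) - (1 - (n₀ - 1) * g) = (n₀ - 1) * g by ring]; exact hm
    · rw [hu2, hu1, hu0, show g⁻¹ * ((1 : K) - (1 - (n₀ - 1) * g)) + (1 - n₀) = 0 by field_simp; ring, map_zero]; exact zero_le
  · rw [chiVec_eq]
    simp only [Fin.isValue, Matrix.cons_val_one, Matrix.cons_val_zero, hu0, hu2, normSign_one σ, mul_one, normSign_of_not_isNorm σ hn₀n]
    decide
  · rw [chiVec_eq]
    simp only [Fin.isValue, Matrix.cons_val_two, Matrix.tail_cons, Matrix.head_cons, hu0, hu1, hω, mul_one,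
      normSign_of_not_isNorm σ hn₀n]
    decide

/-! ## §5  HEAD — the κ-count of the glued class -/

/-- **THE κ-COUNT OF THE GLUED CLASS `latt V(1, 1, g)`** (ramified quadratic datum with `|2| < 1` on a complete `K` with finite residue field; `ρ, t ≥ 1`, `g` fixed with
`|g| = |ϖ|^{2t}`; `ω = normSign σ`):
`kappaCount σ ϖ 0 0 = [2d ≤ ρ + 2t + 1]·ω(−1)ω(1+g)`, `kappaCount σ ϖ 0 1 = [2d ≤ ρ + 1]·ω(−1)ω(g)ω(1+g)`, `kappaCount σ ϖ 0 2 = [2d ≤ ρ + 1]·ω(g)` — by ★ Fκ2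
`kappaCount_zero_eq_of_dichotomy` at the explicit polarisation §1, the windows §4 (deep norms above, the level-`(d−1)` non-norm ★ `exists_fixed_unit_not_norm_v_sub_one_le` as killer
below), and §3.  By §2 the same value on the whole unit-torus orbit. [cite: Kottwitz1986BaseChangeUnits, §1 pp. 240–241] [cite: LanglandsShelstad1987, §3] [cite: Serre1979, Ch. V §3 Prop. 5, Cor. 3] -/
theorem kappaCount_zero_latt_glued_rep [CompleteSpace K] [Finite 𝓀[K]] {σ : K →+* K} {ϖ : K} {d t₂ : ℕ} (hD : IsRamifiedQuadraticDatum σ ϖ d t₂)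
    (h2 : Valued.v (2 : K) < 1) {ρ t : ℕ} (hρ : 1 ≤ ρ) (ht : 1 ≤ t) {g : K} (hσg : σ g = g) (hg : Valued.v g = Valued.v ϖ ^ (2 * t))
    (V : GL (Fin 3) K) (hV : (V : Matrix (Fin 3) (Fin 3) K) = !![1, 0, 0; 1, ϖ ^ ρ, 0; 1 * 1 + g, ϖ ^ ρ * 1, ϖ ^ (2 * ρ + 2 * t)]) (i : Fin 3) :
    kappaCount σ ϖ 0 i (latt (V : Matrix (Fin 3) (Fin 3) K)) =
      (![if 2 * d ≤ ρ + 2 * t + 1 then normSign σ (-1) * normSign σ (1 + g) else 0,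
         if 2 * d ≤ ρ + 1 then normSign σ (-1) * normSign σ g * normSign σ (1 + g) else 0,
         if 2 * d ≤ ρ + 1 then normSign σ g else 0] : Fin 3 → ℤ) i := by
  obtain ⟨hσ, hvσ, hϖ, hfix, hdd, hd1, -⟩ := id hD
  have hϖ0 : ϖ ≠ 0 := (Valuation.ne_zero_iff _).1 (by rw [hϖ]; exact WithZero.exp_ne_zero)
  have hϖ1 : Valued.v ϖ < 1 := by rw [hϖ, ← WithZero.exp_zero, WithZero.exp_lt_exp]; norm_num
  have hvϖ : 0 < Valued.v ϖ := (Valuation.pos_iff _).2 hϖ0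
  -- NI2 with a non-norm witness, on the complete `K`
  obtain ⟨c, hσc, hcn, hdich⟩ := exists_nonnorm_dichotomy hD
  -- `g`, `1 + g`
  have hg0 : g ≠ 0 := fun h => by rw [h, map_zero] at hg; exact (pow_ne_zero _ hvϖ.ne') hg.symm
  have hgv : Valued.v g < 1 := by rw [hg]; exact pow_lt_one₀ zero_le hϖ1 (by omega)
  have h1g : Valued.v (1 + g) = 1 := Valued.v.map_one_add_of_lt hgv
  have h1g0 : 1 + g ≠ 0 := fun h => by rw [h, map_zero] at h1g; exact zero_ne_one h1g
  -- the representative is normalised (`|x| = 1`, `|1 + g| = 1`)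
  have hnorm : IsNormalisedLattice (latt (V : Matrix (Fin 3) (Fin 3) K)) := by
    have h := (F0P3cDyRamDiagonalStableLatticeHNF.normalised_latt_hnf_iff (x := (1 : K)) (y := 1 * 1 + g) (z := ϖ ^ ρ * 1) (p := ϖ ^ ρ)
      (r := ϖ ^ (2 * ρ + 2 * t)) (by simp) (by rw [one_mul, h1g]) (by rw [mul_one, map_pow]; exact pow_le_one₀ zero_le hϖ1.le)
      (by rw [map_pow]; exact pow_le_one₀ zero_le hϖ1.le) (by rw [map_pow]; exact pow_le_one₀ zero_le hϖ1.le)).2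
      ⟨Or.inr (by simp), Or.inr (Or.inl (by rw [one_mul, h1g]))⟩
    rw [hV]; exact h
  -- the explicit polarisation and its letters
  set D₁ : K := ((ϖ * σ ϖ) ^ (ρ + t))⁻¹ with hD₁
  have hσϖ0 : σ ϖ ≠ 0 := fun h => hϖ0 (by rw [← hσ ϖ, h, map_zero])
  have hD₁0 : D₁ ≠ 0 := by rw [hD₁]; exact inv_ne_zero (pow_ne_zero _ (mul_ne_zero hϖ0 hσϖ0))
  have hσD₁ : σ D₁ = D₁ := by rw [hD₁, map_inv₀, map_pow, map_mul, hσ, mul_comm (σ ϖ)]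
  have hσ1g : σ (1 + g) = 1 + g := by rw [map_add, map_one, hσg]
  have hDfix : ∀ j, σ ((![D₁ * g, D₁, -(D₁ * (1 + g)⁻¹)] : Fin 3 → K) j) = (![D₁ * g, D₁, -(D₁ * (1 + g)⁻¹)] : Fin 3 → K) j ∧
      (![D₁ * g, D₁, -(D₁ * (1 + g)⁻¹)] : Fin 3 → K) j ≠ 0 := by
    intro j
    fin_cases j
    · exact ⟨by simp [map_mul, hσD₁, hσg], by simpa using mul_ne_zero hD₁0 hg0⟩
    · exact ⟨by simpa using hσD₁, by simpa using hD₁0⟩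
    · exact ⟨by simp [map_neg, map_mul, map_inv₀, hσD₁, hσ1g], by simpa using mul_ne_zero hD₁0 (inv_ne_zero h1g0)⟩
  have hVL := isVertexLattice_zero_latt_glued_rep hσ hvσ hϖ0 hϖ1 ρ t hσg hg ht V hV
  rw [kappaCount_zero_eq_of_dichotomy hvσ hσc hcn hdich ϖ i V rfl hnorm hDfix hVL, chiVec_glued_rep σ hσ hσc hcn hdich hϖ0 ρ t hσg hg0 h1g0 i]
  -- a level-`(d−1)` non-norm for the killers
  obtain ⟨n₀, hσn₀, hn₀1, hn₀d, hn₀n⟩ := exists_fixed_unit_not_norm_v_sub_one_le hD h2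
  have hn₀d' : Valued.v (n₀ - 1) ≤ Valued.v ϖ ^ (2 * (d - 1)) := by
    rw [v_varpi_pow hϖ]; convert hn₀d using 2; push_cast; ring
  fin_cases i
  · -- slot 0
    simp only [Fin.zero_eta, Fin.isValue, Matrix.cons_val_zero]
    by_cases hwin : 2 * d ≤ ρ + 2 * t + 1
    · rw [if_pos hwin, if_pos]
      intro u hu
      have hu𝒰 : u ∈ fixedUnitTorus σ 3 := ((mem_fixedUnitStabilizer_iff σ _ u).1 hu).2
      exact chiVec_zero_eq_one_of_window hD hwin hu𝒰 ((mem_fixedUnitStabilizer_glued_rep_iff hϖ0 hϖ1.le ρ t hg V hV hu𝒰).1 hu).1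
    · rw [if_neg hwin, if_neg]
      have hlev : Valued.v (n₀ - 1) ≤ Valued.v ϖ ^ (ρ + 2 * t) := hn₀d'.trans (pow_le_pow_right_of_le_one' hϖ1.le (by omega))
      obtain ⟨u, hu, hne⟩ := exists_mem_fixedUnitStabilizer_chiVec_zero_ne_one hϖ0 hϖ1 hρ t hσg hg V hV hσn₀ hn₀1 hlev hn₀n
      exact fun h => hne (h u hu)
  · -- slot 1
    simp only [Fin.mk_one, Fin.isValue, Matrix.cons_val_one, Matrix.cons_val_zero]
    by_cases hwin : 2 * d ≤ ρ + 1
    · rw [if_pos hwin, if_pos]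
      intro u hu
      have hu𝒰 : u ∈ fixedUnitTorus σ 3 := ((mem_fixedUnitStabilizer_iff σ _ u).1 hu).2
      obtain ⟨hb, hc⟩ := (mem_fixedUnitStabilizer_glued_rep_iff hϖ0 hϖ1.le ρ t hg V hV hu𝒰).1 hu
      exact (chiVec_one_two_eq_one_of_window hD hwin hg hu𝒰 hb hc).1
    · rw [if_neg hwin, if_neg]
      have hlev : Valued.v (n₀ - 1) ≤ Valued.v ϖ ^ ρ := hn₀d'.trans (pow_le_pow_right_of_le_one' hϖ1.le (by omega))
      obtain ⟨u, hu, hne, -⟩ := exists_mem_fixedUnitStabilizer_chiVec_one_two_ne_one hϖ0 hϖ1 ρ ht hσg hg V hV hσn₀ hn₀1 hlev hn₀n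
      exact fun h => hne (h u hu)
  · -- slot 2
    simp only [Fin.reduceFinMk, Fin.isValue, Matrix.cons_val_two, Matrix.tail_cons, Matrix.head_cons]
    by_cases hwin : 2 * d ≤ ρ + 1
    · rw [if_pos hwin, if_pos]
      intro u hu
      have hu𝒰 : u ∈ fixedUnitTorus σ 3 := ((mem_fixedUnitStabilizer_iff σ _ u).1 hu).2
      obtain ⟨hb, hc⟩ := (mem_fixedUnitStabilizer_glued_rep_iff hϖ0 hϖ1.le ρ t hg V hV hu𝒰).1 hu
      exact (chiVec_one_two_eq_one_of_window hD hwin hg hu𝒰 hb hc).2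
    · rw [if_neg hwin, if_neg]
      have hlev : Valued.v (n₀ - 1) ≤ Valued.v ϖ ^ ρ := hn₀d'.trans (pow_le_pow_right_of_le_one' hϖ1.le (by omega))
      -- `ω(1 − (n₀ − 1)g) = 1`: `|(n₀−1)g| ≤ |ϖ|^{2(d−1)+2t}`, `2d − 1 ≤ 2(d−1) + 2t`
      have hω : normSign σ (1 - (n₀ - 1) * g) = 1 := by
        refine normSign_eq_one_of_fixed_of_v_sub_one_le hD (by rw [map_sub, map_one, map_mul, map_sub, map_one, hσn₀, hσg])
          (n := 2 * (d - 1) + 2 * t) (by omega) ?_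
        rw [show (1 : K) - (n₀ - 1) * g - 1 = -((n₀ - 1) * g) by ring, Valuation.map_neg, map_mul, hg, pow_add]
        exact mul_le_mul_left hn₀d' _
      obtain ⟨u, hu, -, hne⟩ := exists_mem_fixedUnitStabilizer_chiVec_one_two_ne_one hϖ0 hϖ1 ρ ht hσg hg V hV hσn₀ hn₀1 hlev hn₀n
      exact fun h => hne hω (h u hu)

end Summit.HodgeConjecture.HodgeConjecture.Cruxes.H413.F0P3cDyRamDiagonalKappaGluedClass

end
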